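import Summits.ABC.ABC.Theses.IneffectiveSubspace

/-!
# Stub `stub_lwDeepDictionary` of line `Sketch` — crux `IneffectiveSubspace.DepthCountedABC` (stmt-ABC-14938): LEMMAS

Registered support stub `stub_lwDeepDictionaryLemmas`: THE DEPTH-GROUPED LINEAR FORM OF AN abc
TRIPLE.  For an abc triple `(a, b, c)` write, for `m ∈ {b, c}` and `j ∈ {1, 2, 3, 4}`,
`G_j(m) := ∏ {p ∣ m : v_p(m) = j}` (squarefree layers) and `D_m := {p ∣ m : v_p(m) ≥ 5}` (deep
primes).  Then
* `log m = Σ_{j=1}^{4} j · log G_j(m) + Σ_{p ∈ D_m} v_p(m) · log p` (`lwDeep_log_decomp`),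
* `(∏_j G_j(m)) · ∏_{p ∈ D_m} p = rad m` (`lwDeep_rad_decomp`),

and on the index set `s := {1, 2, 3, 4} ⊔ ((D_b ∪ D_c) + 4)` — of size `≤ 4 + ω₅(abc)`, since
`D_b ∪ D_c ⊆ {p : v_p(abc) ≥ 5}` — the form with `x_j = G_j(c)/G_j(b)`, `u_j = j` (`j ≤ 4`) and
`x_{p+4} = p`, `u_{p+4} = v_p(c) − v_p(b)` (`p ∈ D_b ∪ D_c`) satisfies
(`stub_lwDeepDictionaryLemmas`):
`Σ_{i∈s} u_i log x_i = log c − log b` (telescoping; `b ⟂ c` kills the cross terms),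
`∏_{i∈s} |num x_i| · den x_i = rad b · rad c = rad(bc)` (`G_j(c)/G_j(b)` is reduced because
`G_j(c) ∣ c`, `G_j(b) ∣ b`), and `|u_i| ≤ 4 + log₂ c` (`2^{v_p(m)} ≤ p^{v_p(m)} ≤ m ≤ c`).
This is the arithmetic input of `stub_lwDeepDictionary` (Lang–Waldschmidt in `4 + K` logarithms ⟹
the small member at full size on the cell `ω₅(abc) ≤ K`), proved in
`Theorems/IneffectiveSubspaceDepthCountedABCStubLwDeepDictionary.lean`.

Sources: skeleton `Cruxes/DepthCountedABC/Lines/Sketch.lean` of lead `prover-line-stmt-ABC-14938-0`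
(stub `stub_lwDeepDictionary`; card `depth-grouped-four-logarithms`, "Lang–Waldschmidt in
`n = 4 + K` logarithms").  Mathlib only (`Real.log_nat_eq_sum_factorization`,
`Finset.sum_fiberwise_of_maps_to`, `Nat.radical_eq_prod_primeFactors`,
`UniqueFactorizationMonoid.radical_mul`, `Rat.num_div_eq_of_coprime`, `Rat.den_div_eq_of_coprime`,
`Nat.ordProj_le`, `Nat.le_log_of_pow_le`).  Deliberately NOT here: the Lang–Waldschmidt hypothesis,
the real bookkeeping and the stub `stub_lwDeepDictionary` itself (next file), the other stubs of
the line.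
-/

-- `Summit.<Summit>.<Problem>` is the mandated summit-side namespace (CONVENTIONS §2); for the
-- single-conjunct summit `ABC` the two coincide, so the duplicate `ABC.ABC` is deliberate.
set_option linter.dupNamespace false

namespace Summit.ABC.ABC.Theorems.DepthCountedABC

open scoped BigOperators
open UniqueFactorizationMonoid (radical)

/-! ### Depth grouping of one positive integer -/

/-- A prime of `m` of depth `≤ 4` has depth in `{1, 2, 3, 4}`. [folklore] -/
theorem lwDeep_mapsTo {m p : ℕ}
    (hp : p ∈ m.primeFactors.filter fun p => m.factorization p ≤ 4) :
    m.factorization p ∈ Finset.Icc 1 4 := by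
  obtain ⟨hp, h4⟩ := Finset.mem_filter.1 hp
  obtain ⟨hpp, hpm, hm⟩ := Nat.mem_primeFactors.1 hp
  exact Finset.mem_Icc.2 ⟨hpp.factorization_pos_of_dvd hm hpm, h4⟩

/-- DEPTH GROUPING OF THE LOGARITHM. With the squarefree layers
`G_j(m) := ∏ {p ∣ m : v_p(m) = j}` (`j = 1, …, 4`) and the deep primes `{p ∣ m : v_p(m) > 4}`:
`log m = Σ_{j=1}^{4} j · log G_j(m) + Σ_{p deep} v_p(m) · log p`. [folklore] -/
theorem lwDeep_log_decomp (m : ℕ) :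
    Real.log m =
      ∑ j ∈ Finset.Icc (1 : ℕ) 4, (j : ℝ) * Real.log ((∏ p ∈ (m.primeFactors.filter fun p =>
          m.factorization p ≤ 4).filter (fun p => m.factorization p = j), p : ℕ) : ℝ) +
      ∑ p ∈ m.primeFactors.filter (fun p => ¬ m.factorization p ≤ 4),
        (m.factorization p : ℝ) * Real.log p := by
  rw [Real.log_nat_eq_sum_factorization, Finsupp.sum, Nat.support_factorization,
    ← Finset.sum_filter_add_sum_filter_not m.primeFactors (fun p => m.factorization p ≤ 4)]
  congr 1
  rw [← Finset.sum_fiberwise_of_maps_to (fun p hp => lwDeep_mapsTo hp)]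
  refine Finset.sum_congr rfl fun j _ => ?_
  have hne : ∀ p ∈ (m.primeFactors.filter fun p => m.factorization p ≤ 4).filter
      (fun p => m.factorization p = j), (p : ℝ) ≠ 0 := fun p hp => by
    exact_mod_cast (Nat.prime_of_mem_primeFactors
      (Finset.mem_filter.1 (Finset.mem_filter.1 hp).1).1).ne_zero
  rw [Nat.cast_prod, Real.log_prod hne, Finset.mul_sum]
  refine Finset.sum_congr rfl fun p hp => ?_
  rw [(Finset.mem_filter.1 hp).2]

/-- DEPTH GROUPING OF THE RADICAL: the layers and the deep primes partition the prime factors, so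
`(∏_{j=1}^{4} G_j(m)) · ∏_{p deep} p = rad m`. [folklore] -/
theorem lwDeep_rad_decomp (m : ℕ) :
    (∏ j ∈ Finset.Icc (1 : ℕ) 4, ∏ p ∈ (m.primeFactors.filter fun p =>
        m.factorization p ≤ 4).filter (fun p => m.factorization p = j), p) *
      ∏ p ∈ m.primeFactors.filter (fun p => ¬ m.factorization p ≤ 4), p = radical m := by
  rw [Finset.prod_fiberwise_of_maps_to (fun p hp => lwDeep_mapsTo hp),
    Finset.prod_filter_mul_prod_filter_not, Nat.radical_eq_prod_primeFactors]

/-- Each layer `G_j(m)` is positive. [folklore] -/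
theorem lwDeep_layer_pos (m j : ℕ) :
    0 < ∏ p ∈ (m.primeFactors.filter fun p => m.factorization p ≤ 4).filter
      (fun p => m.factorization p = j), p :=
  Finset.prod_pos fun _ hp =>
    (Nat.prime_of_mem_primeFactors (Finset.mem_filter.1 (Finset.mem_filter.1 hp).1).1).pos

/-- Each layer `G_j(m)` divides `m` (it divides `rad m`). [folklore] -/
theorem lwDeep_layer_dvd (m j : ℕ) :
    (∏ p ∈ (m.primeFactors.filter fun p => m.factorization p ≤ 4).filter
      (fun p => m.factorization p = j), p) ∣ m := by
  have h : (∏ p ∈ m.primeFactors, p) ∣ m := by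
    rw [← Nat.radical_eq_prod_primeFactors]
    exact UniqueFactorizationMonoid.radical_dvd_self
  exact dvd_trans (Finset.prod_dvd_prod_of_subset _ _ _
    ((Finset.filter_subset _ _).trans (Finset.filter_subset _ _))) h

/-- Valuations are logarithmically small: `v_p(m) ≤ log₂ c` whenever `0 < m ≤ c`
(`2^{v_p(m)} ≤ p^{v_p(m)} ≤ m`). [folklore] -/
theorem lwDeep_factorization_le_log {m c : ℕ} (hm : m ≠ 0) (hmc : m ≤ c) (p : ℕ) :
    m.factorization p ≤ Nat.log 2 c := by
  by_cases hp : p.Prime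
  · refine Nat.le_log_of_pow_le one_lt_two ?_
    calc 2 ^ m.factorization p ≤ p ^ m.factorization p := Nat.pow_le_pow_left hp.two_le _
      _ ≤ m := Nat.ordProj_le p hm
      _ ≤ c := hmc
  · simp [Nat.factorization_eq_zero_of_not_prime m hp]

/-! ### The index set `{1, 2, 3, 4} ⊔ (deep primes + 4)` -/

/-- `{1, 2, 3, 4}` is disjoint from the `+4`-shift of a set of nonzero naturals. [folklore] -/
theorem lwDeep_disjoint {E : Finset ℕ} (hE : ∀ p ∈ E, p ≠ 0) :
    Disjoint (Finset.Icc 1 4) (E.map ⟨(· + 4), add_left_injective 4⟩) := by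
  refine Finset.disjoint_left.2 fun i hi hi' => ?_
  obtain ⟨p, hp, rfl⟩ := Finset.mem_map.1 hi'
  have := hE p hp
  simp only [Finset.mem_Icc, Function.Embedding.coeFn_mk] at hi
  omega

/-- Sums over the index set split as `Σ_{j=1}^{4} + Σ_{p ∈ E}`. [folklore] -/
theorem lwDeep_sum_split {E : Finset ℕ} (hE : ∀ p ∈ E, p ≠ 0) (F : ℕ → ℝ) :
    ∑ i ∈ Finset.Icc 1 4 ∪ E.map ⟨(· + 4), add_left_injective 4⟩, F i =
      ∑ j ∈ Finset.Icc 1 4, F j + ∑ p ∈ E, F (p + 4) := by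
  rw [Finset.sum_union (lwDeep_disjoint hE), Finset.sum_map]
  rfl

/-- Products over the index set split as `∏_{j=1}^{4} · ∏_{p ∈ E}`. [folklore] -/
theorem lwDeep_prod_split {E : Finset ℕ} (hE : ∀ p ∈ E, p ≠ 0) (F : ℕ → ℕ) :
    ∏ i ∈ Finset.Icc 1 4 ∪ E.map ⟨(· + 4), add_left_injective 4⟩, F i =
      (∏ j ∈ Finset.Icc 1 4, F j) * ∏ p ∈ E, F (p + 4) := by
  rw [Finset.prod_union (lwDeep_disjoint hE), Finset.prod_map]
  rfl

/-- The index set has `4 + #E` elements. [folklore] -/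
theorem lwDeep_card {E : Finset ℕ} (hE : ∀ p ∈ E, p ≠ 0) :
    (Finset.Icc 1 4 ∪ E.map ⟨(· + 4), add_left_injective 4⟩).card = 4 + E.card := by
  rw [Finset.card_union_of_disjoint (lwDeep_disjoint hE), Finset.card_map, Nat.card_Icc]

/-! ### The linear form of an abc triple in `4 + #deep` logarithms -/

/-- THE FORM TELESCOPES. On the index set `{1,2,3,4} ⊔ (E + 4)`, `E = D_b ∪ D_c`, with
`x_j = G_j(c)/G_j(b)`, `u_j = j` (`j ≤ 4`) and `x_{p+4} = p`, `u_{p+4} = v_p(c) − v_p(b)` (`p ∈ E`),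
the form `Σ u_i log x_i` equals `[Σ_j j log G_j(c) + Σ_{D_c} v_p(c) log p] −
[Σ_j j log G_j(b) + Σ_{D_b} v_p(b) log p]` (the cross terms vanish: `v_p(c) = 0` on `E ∖ D_c`,
`v_p(b) = 0` on `E ∖ D_b`). [folklore] -/
theorem lwDeep_sum_eval {b c : ℕ} {Gb Gc : ℕ → ℕ} {Db Dc : Finset ℕ} {x : ℕ → ℚ} {u : ℕ → ℤ}
    (hGb : ∀ j, 0 < Gb j) (hGc : ∀ j, 0 < Gc j) (hE : ∀ p ∈ Db ∪ Dc, p ≠ 0)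
    (hvc : ∀ p ∈ Db ∪ Dc, p ∉ Dc → c.factorization p = 0)
    (hvb : ∀ p ∈ Db ∪ Dc, p ∉ Db → b.factorization p = 0)
    (hx1 : ∀ j ∈ Finset.Icc 1 4, x j = (Gc j : ℚ) / (Gb j : ℚ))
    (hx2 : ∀ p ∈ Db ∪ Dc, x (p + 4) = p)
    (hu1 : ∀ j ∈ Finset.Icc 1 4, u j = j)
    (hu2 : ∀ p ∈ Db ∪ Dc, u (p + 4) = (c.factorization p : ℤ) - (b.factorization p : ℤ)) :
    ∑ i ∈ Finset.Icc 1 4 ∪ (Db ∪ Dc).map ⟨(· + 4), add_left_injective 4⟩,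
        (u i : ℝ) * Real.log ((x i : ℚ) : ℝ) =
      (∑ j ∈ Finset.Icc (1 : ℕ) 4, (j : ℝ) * Real.log ((Gc j : ℕ) : ℝ) +
          ∑ p ∈ Dc, (c.factorization p : ℝ) * Real.log p) -
        (∑ j ∈ Finset.Icc (1 : ℕ) 4, (j : ℝ) * Real.log ((Gb j : ℕ) : ℝ) +
          ∑ p ∈ Db, (b.factorization p : ℝ) * Real.log p) := by
  rw [lwDeep_sum_split hE]
  have h1 : ∑ j ∈ Finset.Icc 1 4, (u j : ℝ) * Real.log ((x j : ℚ) : ℝ) =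
      ∑ j ∈ Finset.Icc (1 : ℕ) 4, (j : ℝ) * Real.log ((Gc j : ℕ) : ℝ) -
        ∑ j ∈ Finset.Icc (1 : ℕ) 4, (j : ℝ) * Real.log ((Gb j : ℕ) : ℝ) := by
    rw [← Finset.sum_sub_distrib]
    refine Finset.sum_congr rfl fun j hj => ?_
    rw [hu1 j hj, hx1 j hj, Rat.cast_div, Rat.cast_natCast, Rat.cast_natCast,
      Real.log_div (by exact_mod_cast (hGc j).ne') (by exact_mod_cast (hGb j).ne')]
    push_cast
    ring
  have hc' : ∑ p ∈ Dc, (c.factorization p : ℝ) * Real.log p =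
      ∑ p ∈ Db ∪ Dc, (c.factorization p : ℝ) * Real.log p :=
    Finset.sum_subset Finset.subset_union_right fun p hp hpn => by
      rw [hvc p hp hpn, Nat.cast_zero, zero_mul]
  have hb' : ∑ p ∈ Db, (b.factorization p : ℝ) * Real.log p =
      ∑ p ∈ Db ∪ Dc, (b.factorization p : ℝ) * Real.log p :=
    Finset.sum_subset Finset.subset_union_left fun p hp hpn => by
      rw [hvb p hp hpn, Nat.cast_zero, zero_mul]
  have h2 : ∑ p ∈ Db ∪ Dc, (u (p + 4) : ℝ) * Real.log ((x (p + 4) : ℚ) : ℝ) =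
      ∑ p ∈ Db ∪ Dc, (c.factorization p : ℝ) * Real.log p -
        ∑ p ∈ Db ∪ Dc, (b.factorization p : ℝ) * Real.log p := by
    rw [← Finset.sum_sub_distrib]
    refine Finset.sum_congr rfl fun p hp => ?_
    rw [hu2 p hp, hx2 p hp, Rat.cast_natCast]
    push_cast
    ring
  rw [h1, h2, hc', hb']
  ring

/-- THE HEIGHT IS THE RADICAL. With the same data, `G_j(c)/G_j(b)` is a reduced fraction
(`G_j(c) ⟂ G_j(b)`), so
`∏_i |num x_i| · den x_i = (∏_j G_j(b) · ∏_{D_b} p) · (∏_j G_j(c) · ∏_{D_c} p)`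
(`D_b`, `D_c` disjoint). [folklore] -/
theorem lwDeep_height_eval {Gb Gc : ℕ → ℕ} {Db Dc : Finset ℕ} {x : ℕ → ℚ}
    (hGb : ∀ j, 0 < Gb j) (hcop : ∀ j, Nat.Coprime (Gc j) (Gb j))
    (hE : ∀ p ∈ Db ∪ Dc, p ≠ 0) (hdisj : Disjoint Db Dc)
    (hx1 : ∀ j ∈ Finset.Icc 1 4, x j = (Gc j : ℚ) / (Gb j : ℚ))
    (hx2 : ∀ p ∈ Db ∪ Dc, x (p + 4) = p) :
    ∏ i ∈ Finset.Icc 1 4 ∪ (Db ∪ Dc).map ⟨(· + 4), add_left_injective 4⟩,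
        (x i).num.natAbs * (x i).den =
      ((∏ j ∈ Finset.Icc (1 : ℕ) 4, Gb j) * ∏ p ∈ Db, p) *
        ((∏ j ∈ Finset.Icc (1 : ℕ) 4, Gc j) * ∏ p ∈ Dc, p) := by
  rw [lwDeep_prod_split hE]
  have h1 : ∏ j ∈ Finset.Icc 1 4, (x j).num.natAbs * (x j).den =
      ∏ j ∈ Finset.Icc (1 : ℕ) 4, Gc j * Gb j := by
    refine Finset.prod_congr rfl fun j hj => ?_
    have hxj : x j = ((Gc j : ℤ) : ℚ) / ((Gb j : ℤ) : ℚ) := by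
      rw [Int.cast_natCast, Int.cast_natCast]; exact hx1 j hj
    have hGbZ : (0 : ℤ) < (Gb j : ℤ) := by exact_mod_cast hGb j
    have hcopZ : Nat.Coprime ((Gc j : ℤ)).natAbs ((Gb j : ℤ)).natAbs := by
      simpa only [Int.natAbs_natCast] using hcop j
    have hnum : (x j).num = (Gc j : ℤ) := by
      rw [hxj]; exact Rat.num_div_eq_of_coprime hGbZ hcopZ
    have hden : (x j).den = Gb j := by
      have h := Rat.den_div_eq_of_coprime hGbZ hcopZ
      rw [hxj]; exact_mod_cast h
    rw [hnum, hden, Int.natAbs_natCast]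
  have h2 : ∏ p ∈ Db ∪ Dc, (x (p + 4)).num.natAbs * (x (p + 4)).den = ∏ p ∈ Db ∪ Dc, p := by
    refine Finset.prod_congr rfl fun p hp => ?_
    rw [hx2 p hp, Rat.num_natCast, Rat.den_natCast, Int.natAbs_natCast, mul_one]
  rw [h1, h2, Finset.prod_mul_distrib, Finset.prod_union hdisj]
  ring

/-- THE COEFFICIENTS ARE LOGARITHMIC: `|u_i| ≤ 4 + log₂ c` on the index set
(`u_j = j ≤ 4`; `|v_p(c) − v_p(b)| ≤ max ≤ log₂ c` as `b ≤ c`). [folklore] -/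
theorem lwDeep_coeff_bound {b c : ℕ} {Db Dc : Finset ℕ} {u : ℕ → ℤ} (hb : b ≠ 0) (hc : c ≠ 0)
    (hbc : b ≤ c) (hu1 : ∀ j ∈ Finset.Icc 1 4, u j = j)
    (hu2 : ∀ p ∈ Db ∪ Dc, u (p + 4) = (c.factorization p : ℤ) - (b.factorization p : ℤ)) :
    ∀ i ∈ Finset.Icc 1 4 ∪ (Db ∪ Dc).map ⟨(· + 4), add_left_injective 4⟩,
      (u i).natAbs ≤ 4 + Nat.log 2 c := by
  intro i hi
  rcases Finset.mem_union.1 hi with h | h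
  · rw [hu1 i h]
    have := (Finset.mem_Icc.1 h).2
    omega
  · obtain ⟨p, hp, rfl⟩ := Finset.mem_map.1 h
    have h1 := lwDeep_factorization_le_log hc le_rfl p
    have h2 := lwDeep_factorization_le_log hb hbc p
    show (u (p + 4)).natAbs ≤ _
    rw [hu2 p hp]
    omega

/-- THE FORM OF AN abc TRIPLE (abstract depth data). Given layers `G_j(b), G_j(c)` and deep sets
`D_b, D_c` decomposing `log b, log c, rad b, rad c` as in `lwDeep_log_decomp`/`lwDeep_rad_decomp`,
there is a linear form in `4 + #(D_b ∪ D_c) ≤ 4 + ω₅(abc)` logarithms of positive rationals equal to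
`log c − log b`, of height `rad(bc)` and coefficients `≤ 4 + log₂ c`. [folklore] -/
theorem lwDeep_form_of {a b c : ℕ} {Gb Gc : ℕ → ℕ} {Db Dc : Finset ℕ}
    (ha : 0 < a) (hb : 0 < b) (hsum : a + b = c) (hcop : Nat.Coprime a b)
    (hGbpos : ∀ j, 0 < Gb j) (hGcpos : ∀ j, 0 < Gc j) (hGbd : ∀ j, Gb j ∣ b)
    (hGcd : ∀ j, Gc j ∣ c) (hDbP : Db ⊆ b.primeFactors) (hDcP : Dc ⊆ c.primeFactors)
    (hDb5 : ∀ p ∈ Db, 5 ≤ b.factorization p) (hDc5 : ∀ p ∈ Dc, 5 ≤ c.factorization p)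
    (hlogb : Real.log b = ∑ j ∈ Finset.Icc (1 : ℕ) 4, (j : ℝ) * Real.log ((Gb j : ℕ) : ℝ) +
      ∑ p ∈ Db, (b.factorization p : ℝ) * Real.log p)
    (hlogc : Real.log c = ∑ j ∈ Finset.Icc (1 : ℕ) 4, (j : ℝ) * Real.log ((Gc j : ℕ) : ℝ) +
      ∑ p ∈ Dc, (c.factorization p : ℝ) * Real.log p)
    (hradb : (∏ j ∈ Finset.Icc (1 : ℕ) 4, Gb j) * ∏ p ∈ Db, p = radical b)
    (hradc : (∏ j ∈ Finset.Icc (1 : ℕ) 4, Gc j) * ∏ p ∈ Dc, p = radical c) :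
    ∃ (s : Finset ℕ) (x : ℕ → ℚ) (u : ℕ → ℤ),
      s.card ≤ 4 + ((a * b * c).primeFactors.filter
        (fun p => 5 ≤ (a * b * c).factorization p)).card ∧
      (∀ i ∈ s, 0 < x i) ∧
      (∑ i ∈ s, (u i : ℝ) * Real.log ((x i : ℚ) : ℝ)) = Real.log c - Real.log b ∧
      (∏ i ∈ s, (x i).num.natAbs * (x i).den : ℕ) = radical (b * c) ∧
      (∀ i ∈ s, (u i).natAbs ≤ 4 + Nat.log 2 c) := by
  classical
  have hc : 0 < c := by omega
  have hbc : Nat.Coprime b c := by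
    rw [← hsum]; exact Nat.coprime_add_self_right.mpr hcop.symm
  obtain ⟨x, hx⟩ : ∃ x : ℕ → ℚ, x = fun i : ℕ =>
      if i ≤ 4 then (Gc i : ℚ) / (Gb i : ℚ) else ((i - 4 : ℕ) : ℚ) := ⟨_, rfl⟩
  obtain ⟨u, hu⟩ : ∃ u : ℕ → ℤ, u = fun i : ℕ =>
      if i ≤ 4 then (i : ℤ) else
        ((c.factorization (i - 4) : ℕ) : ℤ) - ((b.factorization (i - 4) : ℕ) : ℤ) := ⟨_, rfl⟩
  have hE : ∀ p ∈ Db ∪ Dc, p ≠ 0 := fun p hp => by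
    rcases Finset.mem_union.1 hp with h | h
    · exact (Nat.prime_of_mem_primeFactors (hDbP h)).ne_zero
    · exact (Nat.prime_of_mem_primeFactors (hDcP h)).ne_zero
  have hE4 : ∀ p ∈ Db ∪ Dc, ¬ (p + 4 ≤ 4) := fun p hp => by have := hE p hp; omega
  have hx1 : ∀ j ∈ Finset.Icc 1 4, x j = (Gc j : ℚ) / (Gb j : ℚ) := fun j hj => by
    rw [hx]; exact if_pos (Finset.mem_Icc.1 hj).2
  have hx2 : ∀ p ∈ Db ∪ Dc, x (p + 4) = p := fun p hp => by
    rw [hx]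
    show (if p + 4 ≤ 4 then _ else _) = _
    rw [if_neg (hE4 p hp), Nat.add_sub_cancel]
  have hu1 : ∀ j ∈ Finset.Icc 1 4, u j = j := fun j hj => by
    rw [hu]; exact if_pos (Finset.mem_Icc.1 hj).2
  have hu2 : ∀ p ∈ Db ∪ Dc, u (p + 4) = (c.factorization p : ℤ) - (b.factorization p : ℤ) :=
    fun p hp => by
      rw [hu]
      show (if p + 4 ≤ 4 then _ else _) = _
      rw [if_neg (hE4 p hp), Nat.add_sub_cancel]
  have hdisjP : Disjoint b.primeFactors c.primeFactors := hbc.disjoint_primeFactors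
  have hdisj : Disjoint Db Dc := Finset.disjoint_of_subset_left hDbP
    (Finset.disjoint_of_subset_right hDcP hdisjP)
  have hvc : ∀ p ∈ Db ∪ Dc, p ∉ Dc → c.factorization p = 0 := fun p hp hpn => by
    have hpb : p ∈ b.primeFactors := by
      rcases Finset.mem_union.1 hp with h | h
      · exact hDbP h
      · exact absurd h hpn
    have hpc : p ∉ c.primeFactors := Finset.disjoint_left.1 hdisjP hpb
    rwa [← Nat.support_factorization, Finsupp.notMem_support_iff] at hpc
  have hvb : ∀ p ∈ Db ∪ Dc, p ∉ Db → b.factorization p = 0 := fun p hp hpn => by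
    have hpc : p ∈ c.primeFactors := by
      rcases Finset.mem_union.1 hp with h | h
      · exact absurd h hpn
      · exact hDcP h
    have hpb : p ∉ b.primeFactors := Finset.disjoint_right.1 hdisjP hpc
    rwa [← Nat.support_factorization, Finsupp.notMem_support_iff] at hpb
  have hcopG : ∀ j, Nat.Coprime (Gc j) (Gb j) := fun j =>
    Nat.Coprime.coprime_dvd_right (hGbd j) (Nat.Coprime.coprime_dvd_left (hGcd j) hbc.symm)
  refine ⟨Finset.Icc 1 4 ∪ (Db ∪ Dc).map ⟨(· + 4), add_left_injective 4⟩, x, u, ?_, ?_, ?_, ?_,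
    lwDeep_coeff_bound hb.ne' hc.ne' (by omega) hu1 hu2⟩
  · -- at most `4 + ω₅(abc)` logarithms: `D_b ∪ D_c ⊆ {p : v_p(abc) ≥ 5}`
    rw [lwDeep_card hE]
    refine Nat.add_le_add_left (Finset.card_le_card fun p hp => ?_) 4
    have habc0 : a * b * c ≠ 0 := by positivity
    rcases Finset.mem_union.1 hp with h | h
    · obtain ⟨hpp, hpb, -⟩ := Nat.mem_primeFactors.1 (hDbP h)
      have hdvd : b ∣ a * b * c := ⟨a * c, by ring⟩
      have hle : b.factorization p ≤ (a * b * c).factorization p :=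
        (Nat.factorization_le_iff_dvd hb.ne' habc0).2 hdvd p
      have h5 := hDb5 p h
      exact Finset.mem_filter.2 ⟨Nat.mem_primeFactors.2 ⟨hpp, hpb.trans hdvd, habc0⟩, by omega⟩
    · obtain ⟨hpp, hpc, -⟩ := Nat.mem_primeFactors.1 (hDcP h)
      have hdvd : c ∣ a * b * c := ⟨a * b, by ring⟩
      have hle : c.factorization p ≤ (a * b * c).factorization p :=
        (Nat.factorization_le_iff_dvd hc.ne' habc0).2 hdvd p
      have h5 := hDc5 p h
      exact Finset.mem_filter.2 ⟨Nat.mem_primeFactors.2 ⟨hpp, hpc.trans hdvd, habc0⟩, by omega⟩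
  · -- positivity of the arguments
    intro i hi
    rcases Finset.mem_union.1 hi with h | h
    · rw [hx1 i h]; exact div_pos (by exact_mod_cast hGcpos i) (by exact_mod_cast hGbpos i)
    · obtain ⟨p, hp, rfl⟩ := Finset.mem_map.1 h
      show 0 < x (p + 4)
      rw [hx2 p hp]; exact_mod_cast Nat.pos_of_ne_zero (hE p hp)
  · -- the form telescopes to `log c - log b`
    rw [lwDeep_sum_eval hGbpos hGcpos hE hvc hvb hx1 hx2 hu1 hu2, hlogc, hlogb]
  · -- the height is `rad b · rad c = rad (bc)`
    rw [lwDeep_height_eval hGbpos hcopG hE hdisj hx1 hx2, hradb, hradc,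
      UniqueFactorizationMonoid.radical_mul (Nat.coprime_iff_isRelPrime.mp hbc)]

/-- **Registered support stub `stub_lwDeepDictionaryLemmas` (line `Sketch`, crux stmt-ABC-14938):
THE DEPTH-GROUPED FORM OF AN abc TRIPLE.**  For an abc triple `(a, b, c)` there is a linear form in
at most `4 + ω₅(abc)` logarithms of positive rationals, equal to `log c − log b`, of height exactly
`rad(bc)` and with coefficients `|u_i| ≤ 4 + log₂ c` (instantiate `lwDeep_form_of` with the depth
grouping `lwDeep_log_decomp` / `lwDeep_rad_decomp` of `b` and of `c`). [folklore] -/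
theorem stub_lwDeepDictionaryLemmas : ∀ a b c : ℕ,
    Literature.NumberTheory.DiophantineGeometry.IsABCTriple a b c →
    ∃ (s : Finset ℕ) (x : ℕ → ℚ) (u : ℕ → ℤ),
      s.card ≤ 4 + ((a * b * c).primeFactors.filter
        (fun p => 5 ≤ (a * b * c).factorization p)).card ∧
      (∀ i ∈ s, 0 < x i) ∧
      (∑ i ∈ s, (u i : ℝ) * Real.log ((x i : ℚ) : ℝ)) = Real.log c - Real.log b ∧
      (∏ i ∈ s, (x i).num.natAbs * (x i).den : ℕ) = UniqueFactorizationMonoid.radical (b * c) ∧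
      (∀ i ∈ s, (u i).natAbs ≤ 4 + Nat.log 2 c) :=
  fun _ b c ⟨ha, hb, hsum, hcop⟩ =>
    lwDeep_form_of ha hb hsum hcop (lwDeep_layer_pos b) (lwDeep_layer_pos c) (lwDeep_layer_dvd b)
      (lwDeep_layer_dvd c) (Finset.filter_subset _ _) (Finset.filter_subset _ _)
      (fun p hp => by have := (Finset.mem_filter.1 hp).2; omega)
      (fun p hp => by have := (Finset.mem_filter.1 hp).2; omega)
      (lwDeep_log_decomp b) (lwDeep_log_decomp c) (lwDeep_rad_decomp b) (lwDeep_rad_decomp c)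

end Summit.ABC.ABC.Theorems.DepthCountedABC
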